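import Literature.NumberTheory.Transcendental.KaehlerIdentityLambdaProofs
import Literature.NumberTheory.Transcendental.KaehlerHodgeDelLaplacianGlueProofs
import Literature.NumberTheory.Transcendental.KaehlerHodgeTypeComponentProofs
import Literature.NumberTheory.Transcendental.KaehlerHodgeHarmonicFact
import Literature.NumberTheory.Transcendental.KaehlerHodgeDecompositionGlueProofs
import Literature.NumberTheory.Transcendental.KaehlerHodgeConjFact
import HarnessLib

/-!
# Consequences of the Kähler identity `Δ_d = 2Δ_∂̄` on a Hausdorff Kähler manifold

Trunk **T-KAEHLER** (`NumberTheory/Transcendental`), theorems-only file. With the Kähler identity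
`Δ_d = 2Δ_∂̄` now a theorem for Hausdorff complex manifolds
(`cHodgeLaplacian_eq_two_smul_dolbeaultLaplacian_of_isManifold_complex_of_t2Space`,
`KaehlerIdentityLambdaProofs.lean`; Voisin (2002), Thm. 6.7 via Prop. 6.5), the corrected named facts
of `KaehlerHodge.lean` that the tree had reduced to it by glue follow under `[T2Space M]`, each in one
line (the glue theorem named in the docstring):

* `dolbeaultLaplacian_eq_delLaplacian_of_isManifold_complex_of_t2Space` — `Δ_∂̄ = Δ_∂`
  (Voisin (2002), Thm. 6.7; `KaehlerHodgeDelLaplacianGlueProofs.lean`);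
* `typeComponent_mem_charmonicForms_of_isManifold_complex_of_t2Space`,
  `typeComponent_mem_harmonicForms_of_isManifold_complex_of_t2Space` — `Δ_d` preserves types
  (Voisin (2002), Cor. 6.9; `KaehlerHodgeTypeProofs.lean`, `KaehlerHodgeTypeComponentProofs.lean`);
* `dolbeaultHarmonicForms_le_charmonicForms_of_isManifold_complex_of_t2Space` — `ℋ^{p,q}_{∂̄} ≤ ℋᵏ_ℂ`
  (Voisin (2002), remark after Cor. 6.10; `KaehlerHodgeHarmonicFact.lean`);
* `charmonicForms_eq_iSup_dolbeaultHarmonicForms_of_t2Space` — the harmonic Hodge decomposition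
  `ℋᵏ_ℂ = ⨆_{p+q=k} ℋ^{p,q}` (Voisin (2002), Cor. 6.10; `KaehlerHodgeDecompositionGlueProofs.lean`);
* `dolbeaultHarmonicForms_conj_of_isManifold_complex_of_t2Space` — `\overline{ℋ^{p,q}} = ℋ^{q,p}`
  (Voisin (2002), Cor. 6.12; Huybrechts (2005), Rem. 3.2.7 (i); `KaehlerHodgeConjFact.lean`).

As for the Kähler identity itself, these are not `_holds` discharges of the corrected `def`s (which
bind no separation axiom and thus also speak about non-Hausdorff complex manifolds, more than the
sources); every consumer in the tree has `[T2Space M]` in scope. No named fact is introduced.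

## References

* C. Voisin, *Hodge Theory and Complex Algebraic Geometry I* (2002), §6.1.2, Thm. 6.7, Cor. 6.9,
  Cor. 6.10; §6.1.3, Cor. 6.12. [Voisin2002]
* D. Huybrechts, *Complex Geometry. An Introduction* (2005), Prop. 3.1.12, Prop. 3.2.6, Rem. 3.2.7.
  [Huybrechts2005]
-/

noncomputable section

open scoped Manifold ContDiff Topology
open Bundle Module

namespace Literature.NumberTheory.Transcendental

variable {E : Type*} [NormedAddCommGroup E] [NormedSpace ℂ E]
  {M : Type*} [TopologicalSpace M] [ChartedSpace E M] {k m : ℕ}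
  [FiniteDimensional ℂ E] {n : ℕ} [Fact (finrank ℝ E = n)]
  [IsManifold 𝓘(ℂ, E) ω M] [IsManifold 𝓘(ℝ, E) ∞ M] [T2Space M]
  (g : ContMDiffRiemannianMetric 𝓘(ℝ, E) ∞ E (fun x : M ↦ TangentSpace 𝓘(ℝ, E) x))
  (o : (x : M) → Orientation ℝ (TangentSpace 𝓘(ℝ, E) x) (Fin n))

/-- **The Kähler identity `Δ_∂̄ = Δ_∂`** (the corrected named fact
`dolbeaultLaplacian_eq_delLaplacian_of_isManifold_complex g o`, Voisin (2002), §6.1.2, Thm. 6.7;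
Huybrechts (2005), Prop. 3.1.12 (iii)) on a Hausdorff complex manifold, all degrees: a formal
corollary of `Δ_d = 2Δ_∂̄` (`dolbeaultLaplacian_eq_delLaplacian_of_isManifold_complex_of_cHodgeLaplacian_eq_two_smul`,
`KaehlerHodgeDelLaplacianGlueProofs.lean`) fed
`cHodgeLaplacian_eq_two_smul_dolbeaultLaplacian_of_isManifold_complex_of_t2Space`.
[cite: Voisin2002, §6.1.2 Thm. 6.7] -/
theorem dolbeaultLaplacian_eq_delLaplacian_of_isManifold_complex_of_t2Space :
    dolbeaultLaplacian_eq_delLaplacian_of_isManifold_complex (k := k) (m := m) g o :=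
  dolbeaultLaplacian_eq_delLaplacian_of_isManifold_complex_of_cHodgeLaplacian_eq_two_smul g o
    (cHodgeLaplacian_eq_two_smul_dolbeaultLaplacian_of_isManifold_complex_of_t2Space g o)

/-- **`Δ_d` preserves types** (the corrected named fact
`typeComponent_mem_charmonicForms_of_isManifold_complex g o`: the `(p,q)`-components of a
`Δ_d`-harmonic complex form are `Δ_d`-harmonic; Voisin (2002), §6.1.2, Cor. 6.9) on a Hausdorff
complex manifold, by `typeComponent_mem_charmonicForms_of_isManifold_complex_of_kaehlerIdentity`
(`KaehlerHodgeTypeProofs.lean`). [cite: Voisin2002, §6.1.2 Cor. 6.9] -/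
theorem typeComponent_mem_charmonicForms_of_isManifold_complex_of_t2Space :
    typeComponent_mem_charmonicForms_of_isManifold_complex (k := k) (m := m) g o :=
  typeComponent_mem_charmonicForms_of_isManifold_complex_of_kaehlerIdentity g o
    (cHodgeLaplacian_eq_two_smul_dolbeaultLaplacian_of_isManifold_complex_of_t2Space g o)

/-- **`Δ_d` preserves types, real form** (the corrected named fact
`typeComponent_mem_harmonicForms_of_isManifold_complex g o`; Voisin (2002), §6.1.2, Cor. 6.9 with
Thm. 5.23) on a Hausdorff complex manifold, by `typeComponent_mem_harmonicForms_of_kaehlerIdentity`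
(`KaehlerHodgeTypeComponentProofs.lean`). [cite: Voisin2002, §6.1.2 Cor. 6.9] -/
theorem typeComponent_mem_harmonicForms_of_isManifold_complex_of_t2Space :
    typeComponent_mem_harmonicForms_of_isManifold_complex (k := k) (m := m) g o :=
  typeComponent_mem_harmonicForms_of_kaehlerIdentity g o
    (cHodgeLaplacian_eq_two_smul_dolbeaultLaplacian_of_isManifold_complex_of_t2Space g o)

/-- **`ℋ^{p,q}_{∂̄} ≤ ℋᵏ_ℂ`** (the corrected named fact
`dolbeaultHarmonicForms_le_charmonicForms_of_isManifold_complex g o`: on a Kähler manifold the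
`∂̄`-harmonic `(p,q)`-forms are `Δ_d`-harmonic; Voisin (2002), §6.1.2, remark after Cor. 6.10) on a
Hausdorff complex manifold, by
`dolbeaultHarmonicForms_le_charmonicForms_of_isManifold_complex_of_kaehlerIdentity`
(`KaehlerHodgeHarmonicFact.lean`). [cite: Voisin2002, §6.1.2 Cor. 6.10] -/
theorem dolbeaultHarmonicForms_le_charmonicForms_of_isManifold_complex_of_t2Space :
    dolbeaultHarmonicForms_le_charmonicForms_of_isManifold_complex (k := k) (m := m) g o :=
  dolbeaultHarmonicForms_le_charmonicForms_of_isManifold_complex_of_kaehlerIdentity g o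
    (cHodgeLaplacian_eq_two_smul_dolbeaultLaplacian_of_isManifold_complex_of_t2Space g o)

/-- **The harmonic Hodge decomposition `ℋᵏ_ℂ = ⨆_{p+q=k} ℋ^{p,q}_{∂̄}`** for the metric `g`
(the predicate `charmonicForms_eq_iSup_dolbeaultHarmonicForms g o` of `KaehlerHodge.lean`;
Voisin (2002), §6.1.2, Cor. 6.10; Huybrechts (2005), Prop. 3.2.6 (ii)) on a Hausdorff complex
manifold, by `charmonicForms_eq_iSup_dolbeaultHarmonicForms_of_kaehlerIdentity`
(`KaehlerHodgeDecompositionGlueProofs.lean`). [cite: Voisin2002, §6.1.2 Cor. 6.10] -/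
theorem charmonicForms_eq_iSup_dolbeaultHarmonicForms_of_t2Space :
    charmonicForms_eq_iSup_dolbeaultHarmonicForms (k := k) (m := m) g o :=
  charmonicForms_eq_iSup_dolbeaultHarmonicForms_of_kaehlerIdentity g o
    (cHodgeLaplacian_eq_two_smul_dolbeaultLaplacian_of_isManifold_complex_of_t2Space g o)

/-- **Conjugation swaps `ℋ^{p,q}` and `ℋ^{q,p}`** (the corrected named fact
`dolbeaultHarmonicForms_conj_of_isManifold_complex g o`; Voisin (2002), §6.1.2, Thm. 6.7 with
Cor. 6.10, §6.1.3, Cor. 6.12; Huybrechts (2005), Rem. 3.2.7 (i)) on a Hausdorff complex manifold,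
by `dolbeaultHarmonicForms_conj_of_isManifold_complex_of_cHodgeLaplacian_eq_two_smul`
(`KaehlerHodgeConjFact.lean`). [cite: Voisin2002, §6.1.3 Cor. 6.12] -/
theorem dolbeaultHarmonicForms_conj_of_isManifold_complex_of_t2Space :
    dolbeaultHarmonicForms_conj_of_isManifold_complex (k := k) (m := m) g o :=
  dolbeaultHarmonicForms_conj_of_isManifold_complex_of_cHodgeLaplacian_eq_two_smul g o
    (cHodgeLaplacian_eq_two_smul_dolbeaultLaplacian_of_isManifold_complex_of_t2Space g o)

end Literature.NumberTheory.Transcendental
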